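import Summits.AnomalousDissipation.AnomalousDissipation.Theses.FrustratedForces
import Literature.Analysis.FluidPDE.DoeringFoiasPowerProofs
import Literature.Analysis.FluidPDE.DuchonRobertLionsCounterexample
import Literature.Analysis.FluidPDE.StatisticalSolutionEnergyEq

/-!
# Refutation of `FrustratedForces.EnsembleCeilingBridge` (stmt-AnomalousDissipation-2984): data of any mean

`EnsembleCeilingBridge` (route `AnomalousDissipation/FrustratedForces`, support) claims, for every smooth
divergence-free mean-zero steady force `f` and `ν > 0`: if every stationary statistical solution `μ` of
`(ν, f)` (a measure on the MEAN-ZERO energy space `H = Torus.energySpace`) with integrable energy has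
`ensembleEnergy μ ≤ E`, then every global Leray–Hopf solution `u` of NS_ν(f), from ANY `L²` datum, has
`meanEnergy u ≤ E`. Stationary statistical solutions live on mean-zero fields, Leray–Hopf data need not:
take `f = 0`, `ν = 1`, `E = 0`. By the support bound `Torus.IsStationaryStatisticalSolution.ae_norm_le`
(FMRT Ch. IV (1.34), proved in tree) every stationary statistical solution of `(1, 0)` is carried by
`{‖u‖ ≤ ‖0‖₂/(4π²)} = {0}`, so the hypothesis holds with `E = 0`; but the steady constant flow `u ≡ e₀`
is a global Leray–Hopf solution with zero force (`isLerayHopfOn_const`, in tree) and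
`meanEnergy ≡ ‖e₀‖² = 1 > 0`. FIX (planner restate, as for `GPEnergyCeiling`): add `Torus.HasZeroMean u₀ →`
in the conclusion. Route review 2026-08-15, refuter-rreview-route-NavierStokesRegula-dc168335-0.
-/

namespace Summit.AnomalousDissipation.AnomalousDissipation.Theses.FrustratedForces

open scoped BigOperators Topology Manifold Classical MeasureTheory ProbabilityTheory Matrix InnerProductSpace ComplexConjugate ContinuousMap
open Filter Set Function TopologicalSpace MeasureTheory

/-- **Record of the replaced/dropped route item `EnsembleCeilingBridge`** = stmt-AnomalousDissipation-2984 (ledger signature verbatim, in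
the route file's namespace and `open` context; NOT a route item): after `FrustratedForcesEnsembleCeilingBridge_refuted` (below) closed the
item `refuted`, the route repair (`restate` under a new name, or `drop`) removed
this constant from the gate-written Theses file, while the Theorems file below — append-only,
statement text fixed — still names it ("Unknown identifier" in the full builds of 2026-08-16).
Re-declared here under its original fully-qualified name and definiens solely so that this record
keeps elaborating. FALSE (refuted below). -/
def EnsembleCeilingBridge : Prop :=
  ∀ f : UnitAddTorus (Fin 3) → EuclideanSpace ℝ (Fin 3), Literature.Analysis.FunctionSpaces.Torus.IsSmooth f → Literature.Analysis.FunctionSpaces.Torus.IsDivFree f → Literature.Analysis.FunctionSpaces.Torus.HasZeroMean f → ∀ (ν E : ℝ), 0 < ν → (∀ μ : MeasureTheory.Measure (Literature.Analysis.FunctionSpaces.Torus.energySpace (Fin 3)), Literature.Analysis.FluidPDE.Torus.IsStationaryStatisticalSolution ν f μ → MeasureTheory.Integrable (fun u => ‖u‖ ^ 2) μ → Literature.Analysis.FluidPDE.Torus.ensembleEnergy μ ≤ E) → ∀ (u₀ : UnitAddTorus (Fin 3) → EuclideanSpace ℝ (Fin 3)) (u : ℝ → UnitAddTorus (Fin 3)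 → EuclideanSpace ℝ (Fin 3)), Literature.Analysis.FluidPDE.Torus.IsGlobalLerayHopf ν (fun _ => f) u₀ u → Literature.Analysis.FluidPDE.meanEnergy u ≤ E

end Summit.AnomalousDissipation.AnomalousDissipation.Theses.FrustratedForces

namespace Summit.AnomalousDissipation.AnomalousDissipation.Theorems

open scoped BigOperators Topology ENNReal InnerProductSpace RealInnerProductSpace
open Filter Set MeasureTheory UnitAddTorus
open Literature.Analysis Literature.Analysis.FunctionSpaces Literature.Analysis.FluidPDE

/-- Refutes `FrustratedForces.EnsembleCeilingBridge` (stmt-AnomalousDissipation-2984): with `f = 0`,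
`ν = 1`, `E = 0` the ensemble hypothesis holds (stationary statistical solutions of unforced NS are
`δ₀`-like: `‖u‖ ≤ 0` a.e. by the FMRT support bound) while the constant flow `u ≡ e₀` is global
Leray–Hopf with `meanEnergy = 1`; witness: Galilean drift of the datum. [folklore] -/
theorem FrustratedForcesEnsembleCeilingBridge_refuted :
    ¬ Summit.AnomalousDissipation.AnomalousDissipation.Theses.FrustratedForces.EnsembleCeilingBridge := by
  intro h
  -- the zero force
  have hf : Torus.IsSmooth (0 : UnitAddTorus (Fin 3) → EuclideanSpace ℝ (Fin 3)) :=
    Torus.isSmooth_const (0 : EuclideanSpace ℝ (Fin 3))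
  have hdiv : Torus.IsDivFree (0 : UnitAddTorus (Fin 3) → EuclideanSpace ℝ (Fin 3)) :=
    isDivFree_fun_const (0 : EuclideanSpace ℝ (Fin 3))
  have h0 : Torus.HasZeroMean (0 : UnitAddTorus (Fin 3) → EuclideanSpace ℝ (Fin 3)) := by
    simp [Torus.HasZeroMean]
  have hfL2 : MemLp (0 : UnitAddTorus (Fin 3) → EuclideanSpace ℝ (Fin 3)) 2 volume := hf.memLp 2
  -- (i) every stationary statistical solution of `(ν, f) = (1, 0)` has zero ensemble energy
  have hSSS : ∀ μ : Measure (Torus.energySpace (Fin 3)),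
      Torus.IsStationaryStatisticalSolution 1 (0 : UnitAddTorus (Fin 3) → EuclideanSpace ℝ (Fin 3)) μ →
      Integrable (fun u : Torus.energySpace (Fin 3) => ‖u‖ ^ 2) μ → Torus.ensembleEnergy μ ≤ 0 := by
    intro μ hμ _
    have hae := hμ.ae_norm_le one_pos hfL2
    have hz : ‖hfL2.toLp (0 : UnitAddTorus (Fin 3) → EuclideanSpace ℝ (Fin 3))‖ = 0 := by
      rw [MemLp.toLp_zero, norm_zero]
    rw [hz, zero_div] at hae
    have hae' : (fun u : Torus.energySpace (Fin 3) => ‖u‖ ^ 2) =ᵐ[μ] 0 := by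
      filter_upwards [hae] with u hu
      have : ‖u‖ = 0 := le_antisymm hu (norm_nonneg _)
      simp [this]
    unfold Torus.ensembleEnergy
    rw [integral_eq_zero_of_ae hae']
  -- (ii) the constant flow `u ≡ e₀` is a global Leray–Hopf solution with zero force and mean energy `1`
  set m : EuclideanSpace ℝ (Fin 3) := EuclideanSpace.single (0 : Fin 3) (1 : ℝ) with hm
  have hnorm : ‖m‖ = 1 := by
    rw [hm, PiLp.norm_single, norm_one]
  have hu : Torus.IsGlobalLerayHopf 1 (fun _ : ℝ => (0 : UnitAddTorus (Fin 3) → EuclideanSpace ℝ (Fin 3)))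
      (fun _ => m) (fun (_ : ℝ) (_ : UnitAddTorus (Fin 3)) => m) :=
    fun T hT => isLerayHopfOn_const hT 1 m
  have hE : meanEnergy (fun (_ : ℝ) (_ : UnitAddTorus (Fin 3)) => m) = 1 := by
    rw [meanEnergy_eq_longTimeAvgSup]
    unfold longTimeAvgSup
    have hev : (timeMean fun _ : ℝ => ∫ _x : UnitAddTorus (Fin 3), ‖m‖ ^ 2) =ᶠ[atTop]
        fun _ => (1 : ℝ) := by
      filter_upwards [eventually_gt_atTop (0 : ℝ)] with T hT
      unfold timeMean
      rw [hnorm, intervalIntegral.integral_const]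
      simp only [one_pow, integral_const, smul_eq_mul, mul_one, sub_zero]
      simp [hT.ne']
    rw [limsup_congr hev, limsup_const]
  -- (iii) contradiction
  have h1 := h 0 hf hdiv h0 1 0 one_pos hSSS (fun _ => m) (fun _ _ => m) hu
  rw [hE] at h1
  linarith

end Summit.AnomalousDissipation.AnomalousDissipation.Theorems
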